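import Summits.Langlands.Langlands.Statement
import Literature.NumberTheory.Automorphic.KimShahidiSymmetricPowers
import HarnessLib

/-!
# F3 WITNESS — line `BianchiSymmPowerGaloisToAutomorphic` (crux `ReciprocityUpToIrreducibility`, item stmt-Langlands-14328)
# forward generator G4 ladder-down, generation 29 — the rung SPECIALISES to its proved floor (0 sorry)

DIAL θ31 = the class of base fields over which all symmetric powers `Symᵐ` (`m ≥ 1`) of the regular algebraic
cuspidal automorphic representations of `GL₂` are automorphic, read in clause (B) of the top (a.e.-Satake form,
Galois-typed: family `SymmPowerRAGaloisToAutomorphicOn 𝒦`, bigger class = stronger, `…_mono`).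

* FLOOR `𝒦₀ = TotallyRealClass`: Newton–Thorne, *Symmetric power functoriality for Hilbert modular forms*,
  arXiv:2212.03595 (Thm. A, p. 3: `F` totally real, `π` cuspidal on `GL₂(𝔸_F)` without CM with `π_∞` essentially
  square-integrable ⇒ `Symⁿ⁻¹ π` exists as a cuspidal automorphic representation of `GL_n(𝔸_F)` for every `n ≥ 2`,
  compatible with `rec` at every place; footnote 1: in the CM case the symmetric power liftings exist by the theory
  of Eisenstein series).  Datum-model a.e. rendering `NewtonThorne2022SymmPowerText` (regular algebraic `π`; an
  automorphic `P` on `GL_{m+1}` with the `Symᵐ` Satake parameters a.e.), used as a hypothesis (the Literature model: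
  an unproved-here published theorem is a named `Prop`); the `F = ℚ` cell is the tree's `L²`-model fact
  `Literature.NumberTheory.Automorphic.NewtonThorne2021_exists_cuspidal_symmPowerLift` (Newton–Thorne 2021 I/II).
  BRIDGE `floor_newtonThorne : NewtonThorne2022SymmPowerText → SymmPowerRAGaloisToAutomorphicOn TotallyRealClass`
  and the F3 literal `example`.
* SIDE FLOORS (print-decided cells beside the chain, over EVERY number field and every cuspidal `π`): `m = 1`
  (tautology), `m = 2` Gelbart–Jacquet 1978 (`GelbartJacquet_symmSq_automorphic`), `m = 3` Kim–Shahidi 2002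
  (`KimShahidi2002_symmCube_automorphic`), `m = 4` Kim 2003 (`Kim2003_symmFourth_automorphic`) — all in tree — via
  `sectorB_of_weakSymmPowerFunctoriality`.
* RUNG `𝒦₁ = TotallyRealOrImagQuadClass` (= `BianchiSymmPowerGaloisToAutomorphic`, the skeleton
  `Lines/BianchiSymmPowerGaloisToAutomorphic.lean`): adds exactly the BIANCHI cell (imaginary quadratic `K`,
  `m ≥ 5`, `π` regular algebraic cuspidal on `GL₂(𝔸_K)`), where only POTENTIAL automorphy of `Symᵐ` is in print
  (Boxer–Calegari–Gee–Newton–Thorne, arXiv:2309.15880, Thm. C / Thm. 7.2.1).  `floorFamily_of_rung : rung → floor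
  family value` orders the ladder.
-/

noncomputable section

set_option linter.dupNamespace false

open scoped MatrixGroups Matrix NumberField Classical Polynomial
open Filter IsDedekindDomain Field Polynomial
open Literature.NumberTheory.Automorphic Literature.NumberTheory.GaloisRepresentations
open Literature.NumberTheory.PAdicHodge
open Summit.Langlands

namespace Summit.Langlands.Langlands.Cruxes.ReciprocityUpToIrreducibility.BianchiSymmPowerGaloisToAutomorphic

/-! ## 1. The dial: classes of number fields -/

/-- The class of totally real number fields (the floor's class). [folklore] -/
def TotallyRealClass : ∀ (K : Type) [Field K] [NumberField K], Prop :=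
  fun K _ _ => NumberField.IsTotallyReal K

/-- `K` is imaginary quadratic: totally complex of degree `2` (the summit's convention, cf. routes
`ImaginaryQuadraticAnchor`, `FifteenLocusEisenstein`). [folklore] -/
def IsImaginaryQuadratic (K : Type) [Field K] [NumberField K] : Prop :=
  NumberField.IsTotallyComplex K ∧ Module.finrank ℚ K = 2

/-- The rung's class: totally real OR imaginary quadratic. [folklore] -/
def TotallyRealOrImagQuadClass : ∀ (K : Type) [Field K] [NumberField K], Prop :=
  fun K _ _ => NumberField.IsTotallyReal K ∨ IsImaginaryQuadratic K

/-! ## 2. The rung family (clause (B), `Symᵐ`-sector of regular algebraic `π` on `GL₂`, a.e.-Satake form) -/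

/-- **Clause (B) on the `Symᵐ`-sector of regular algebraic cuspidal `π` on `GL₂(𝔸_K)`** (one degree `m`, one
field `K`): for every regular algebraic cuspidal `π` on `GL₂(𝔸_K)`, every prime `ℓ`, `ι : ℚ̄_ℓ ≃+* ℂ` and every
IRREDUCIBLE `ρ : Γ_K → GL_{m+1}(ℚ̄_ℓ)` that is de Rham above `ℓ` (pinned Fontaine datum) and whose arithmetic
Frobenius at a.e. finite place `v` has characteristic polynomial the `ι`-Satake polynomial of
`Symᵐ{a, b} = symmPowerParams m a b`, `{a, b}` the Satake pair of `π_v`: there is an automorphic representation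
`P` of `GL_{m+1}(𝔸_K)` (Borel–Jacquet datum) Satake–Frobenius compatible with `ρ` at a.e. `v`. -/
def SymmPowerRASectorB (m : ℕ) (K : Type) [Field K] [NumberField K] : Prop :=
  ∀ (h2 : isCompact_glFiniteIntegralLevel 2 K) (π : CuspidalAutomorphicRepData 2 K h2),
    π.1.IsRegularAlgebraic →
    ∀ (ℓ : ℕ) [Fact ℓ.Prime] (ι : PadicAlgCl ℓ ≃+* ℂ) (ρ : FramedGaloisRep K (PadicAlgCl ℓ) (m + 1)),
      ρ.toGaloisRep.IsIrreducible →
      (∀ (v : HeightOneSpectrum (𝓞 K)) (hv : ((ℓ : ℕ) : 𝓞 K) ∈ v.asIdeal),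
          (fontainePstAdicCompletion v ℓ hv).IsDeRhamFramed (ρ.toLocal v)) →
      (∀ᶠ v : HeightOneSpectrum (𝓞 K) in cofinite, ∃ a b : ℂ, π.1.HasSatakeParamAt v {a, b} ∧
          ρ.IsUnramifiedAt v ∧
          ρ.HasFrobCharpolyAt v (arithFrobPolyOfSatake ι v.residueCard 1 (symmPowerParams m a b))) →
      ∀ hm : isCompact_glFiniteIntegralLevel (m + 1) K,
        ∃ P : AutomorphicRepData (AutomorphyDatum.gl (m + 1) K hm),
          ∀ᶠ v : HeightOneSpectrum (𝓞 K) in cofinite, SatakeFrobCompatibleAt ι P ρ v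

/-- **The RUNG FAMILY over a class `𝒦` of number fields**: all degrees `m ≥ 1` over every field of the class. -/
def SymmPowerRAGaloisToAutomorphicOn (𝒦 : ∀ (K : Type) [Field K] [NumberField K], Prop) : Prop :=
  ∀ (K : Type) [Field K] [NumberField K], 𝒦 K → ∀ m : ℕ, 1 ≤ m → SymmPowerRASectorB m K

/-- **THE RUNG** (the filed statement): the family over the class "totally real or imaginary quadratic" —
the new (open) cell is `Symᵐ`, `m ≥ 5`, of genuinely Bianchi regular algebraic cuspidal `π`. -/
def BianchiSymmPowerGaloisToAutomorphic : Prop :=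
  SymmPowerRAGaloisToAutomorphicOn TotallyRealOrImagQuadClass

/-- Class monotonicity: a bigger class gives a stronger statement. [folklore] -/
theorem symmPowerRAGaloisToAutomorphicOn_mono {𝒦 𝒦' : ∀ (K : Type) [Field K] [NumberField K], Prop}
    (h𝒦 : ∀ (K : Type) [Field K] [NumberField K], 𝒦 K → 𝒦' K)
    (h : SymmPowerRAGaloisToAutomorphicOn 𝒦') : SymmPowerRAGaloisToAutomorphicOn 𝒦 :=
  fun K _ _ hK => h K (h𝒦 K hK)

/-- The rung implies the floor's family value (totally real ⊆ totally real ∪ imaginary quadratic): the ladder is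
ordered. [folklore] -/
@[aesop safe apply]
theorem floorFamily_of_rung (h : BianchiSymmPowerGaloisToAutomorphic) :
    SymmPowerRAGaloisToAutomorphicOn TotallyRealClass :=
  symmPowerRAGaloisToAutomorphicOn_mono (fun _ _ _ hK => Or.inl hK) h

/-! ## 3. The floor (F3 witness) and the side floors -/

/-- **Newton–Thorne 2022, Thm. A + footnote 1** (datum-model a.e. rendering): for `F` totally real and `π` a
regular algebraic cuspidal automorphic representation of `GL₂(𝔸_F)` (= "`π_∞` essentially square-integrable" and
algebraic, i.e. a cuspidal Hilbert eigenform of weights `k_v ≥ 2`), every `Symᵐ π`, `m ≥ 1`, exists as an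
automorphic representation of `GL_{m+1}(𝔸_F)` with the `Symᵐ` Satake parameters at a.e. place (cuspidal when `π`
is not CM, Thm. A; by Eisenstein series when `π` is CM, footnote 1).  Text, used as a hypothesis; the `F = ℚ`
cell is the tree's `L²`-model fact `NewtonThorne2021_exists_cuspidal_symmPowerLift`.
[cite: arXiv:2212.03595, Thm. A (p. 3) and footnote 1] -/
def NewtonThorne2022SymmPowerText : Prop :=
  ∀ (F : Type) [Field F] [NumberField F] [NumberField.IsTotallyReal F]
    (h2 : isCompact_glFiniteIntegralLevel 2 F) (π : CuspidalAutomorphicRepData 2 F h2),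
    π.1.IsRegularAlgebraic → ∀ (m : ℕ), 1 ≤ m → ∀ (hm : isCompact_glFiniteIntegralLevel (m + 1) F),
      ∃ P : AutomorphicRepData (AutomorphyDatum.gl (m + 1) F hm), IsSymmPowerLiftAE m π.1 P

/-- An a.e. `Symᵐ`-lift of `π` settles clause (B) on the `Symᵐ`-sector of `π` (the bridge of generation 7,
with the regular-algebraic hypothesis carried along). [folklore] -/
theorem sectorB_of_exists_lift (m : ℕ) {K : Type} [Field K] [NumberField K]
    (h : ∀ (h2 : isCompact_glFiniteIntegralLevel 2 K) (π : CuspidalAutomorphicRepData 2 K h2),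
      π.1.IsRegularAlgebraic → ∀ (hm : isCompact_glFiniteIntegralLevel (m + 1) K),
        ∃ P : AutomorphicRepData (AutomorphyDatum.gl (m + 1) K hm), IsSymmPowerLiftAE m π.1 P) :
    SymmPowerRASectorB m K := by
  intro h2 π hRA ℓ _ ι ρ _ _ hsym hm
  obtain ⟨P, hP⟩ := h h2 π hRA hm
  refine ⟨P, ?_⟩
  filter_upwards [hsym, hP] with v hv hPv
  obtain ⟨a, b, hπ, hur, hcp⟩ := hv
  exact ⟨symmPowerParams m a b, hPv a b hπ, hur, hcp⟩

/-- **FLOOR BRIDGE (F3)**: Newton–Thorne 2022 gives the family over the class of totally real fields. -/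
theorem floor_newtonThorne (h : NewtonThorne2022SymmPowerText) :
    SymmPowerRAGaloisToAutomorphicOn TotallyRealClass := by
  intro K _ _ hK m hm
  haveI : NumberField.IsTotallyReal K := hK
  exact sectorB_of_exists_lift m fun h2 π hRA hmK => h K h2 π hRA m hm hmK

/-- F3 literal: the floor value of the family specialises to the cited theorem. -/
example (h : NewtonThorne2022SymmPowerText) : SymmPowerRAGaloisToAutomorphicOn TotallyRealClass :=
  floor_newtonThorne h

/-- **Side floors** (print-decided cells INSIDE the rung and above it): weak `Symᵐ` functoriality in degree `m`
over every number field settles the degree-`m` cell over every field. [folklore] -/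
theorem sectorB_of_weakSymmPowerFunctoriality (m : ℕ) (h : WeakSymmPowerFunctoriality m)
    (K : Type) [Field K] [NumberField K] : SymmPowerRASectorB m K :=
  sectorB_of_exists_lift m fun h2 π _ hm => h K h2 hm π

/-- `m = 1` is tautological over every field. [folklore] -/
theorem sectorB_one (K : Type) [Field K] [NumberField K] : SymmPowerRASectorB 1 K :=
  sectorB_of_weakSymmPowerFunctoriality 1 weakSymmPowerFunctoriality_one K

/-- `m = 2` over every field: Gelbart–Jacquet 1978 (in-tree named fact). -/
theorem sectorB_two (hGJ : GelbartJacquet_symmSq_automorphic) (K : Type) [Field K] [NumberField K] :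
    SymmPowerRASectorB 2 K :=
  sectorB_of_weakSymmPowerFunctoriality 2 (weakSymmPowerFunctoriality_two_of_GelbartJacquet hGJ) K

/-- `m = 3` over every field: Kim–Shahidi 2002 (in-tree text). -/
theorem sectorB_three (h : KimShahidi2002_symmCube_automorphic) (K : Type) [Field K] [NumberField K] :
    SymmPowerRASectorB 3 K :=
  sectorB_of_weakSymmPowerFunctoriality 3 h K

/-- `m = 4` over every field: Kim 2003 (in-tree text). -/
theorem sectorB_four (h : Kim2003_symmFourth_automorphic) (K : Type) [Field K] [NumberField K] :
    SymmPowerRASectorB 4 K :=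
  sectorB_of_weakSymmPowerFunctoriality 4 h K

end Summit.Langlands.Langlands.Cruxes.ReciprocityUpToIrreducibility.BianchiSymmPowerGaloisToAutomorphic

end
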